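import Literature.MathematicalPhysics.QuantumFieldTheory.Balaban1983to89.T4HistoryLipschitzLinearSize

/-!
# NE9 (node U3, history side) — repair item NE9-F8 «d-CURRENCY DISCHARGERS», part 1a: the (1.26)∕(2.29)-TYPE ENTROPY
BOUND IN THE LINEAR SIZE, on any coordinate group

Cell `pub-balaban`, T⁴ programme, row NE9 of `BINDER-OWNERS.md`; unit `b2b-balaban-t4-ne9-formalise-leaf-05-g2` (NE9
formalisation swarm, LEAF PROVER 05, gen 2), repair item NE9-F8 offered by the census finding F-ne9leaf01-1 of
`b2b-balaban-t4-ne9-formalise-leaf-01` (CLAIMS.log l.6309): the tree's only producers of the NE9 END binders `TwoPointKP`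
(A1), `DecayExtract` (G1), `PinBudget` (G2) — road P2's `T4HistoryLipschitzEntropy.kp_of_decay_touch`,
`Supported.decayExtract_of_cover`, `Supported.pinBudget_of_pinSize` — count decay PER CUBE, so that converting the printed
decay in the LINEAR SIZE `d_k(X)` ([II] Lemma 3 (2.38) p.20) through `#X ≤ 2^ν (d(X) + 1)`
(`T4HistoryLipschitzLinearSize.card_le_two_pow_mul_linSize_succ`) DIVIDES the usable rate by `2^ν` (= 16 on T⁴).  Print's
own bookkeeping works in the currency of `d_k` throughout and loses only ADDITIVELY, through the lattice inequality [II] (1.26)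
p.8 «Σ_{X∈𝐃_j, X⊃□′} exp(−κd_j(X)) ≤ O(1), (1.26) for κ sufficiently large» (= (2.29) p.18 in the cluster expansion).

THIS FILE proves that inequality IN THE KERNEL for the tree's lattice-edge linear size `linSize` of
`T4HistoryLipschitzLinearSize` (the second formulation of [I] p.257), over ANY coordinate group `G` (sites `Fin ν → G`; the
discrete torus `G = ZMod N` of the cell's cube charts included, so no ℤᵈ-versus-torus transfer and no identification with the
sup-metric `treeLen` of `B12Ext436Lattice` is needed):

* §1 the wall adjacency `WallAdj` has degree `≤ 2ν` on any coordinate group (`card_filter_wallAdj_le`);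
* §2 every point of a lattice skeleton of a nonempty cube family is a corner of one of its cubes
  (`exists_isCorner_of_mem_skeleton`), and a skeleton is a `WallAdj`-connected set of lattice points
  (`isConn_wallAdj_of_isSkeleton`) — so a MINIMAL skeleton (`exists_isSkeleton_card_eq`, `#S = d(X) + 1`) is a lattice animal
  of `d(X) + 1` points through one of the `2^ν` corners of any given cube of `X`, and it corners at most `2^ν·#S` cubes
  (`card_le_two_pow_mul_card`);
* §3 **`sum_exp_neg_mul_linSize_le`**: for a finite region `Λ` of cubes, a cube `x` and reals `κ, θ` with
  `2^(2^ν)·e^{−κ}·e^{2ν·θ} ≤ θ`:  `Σ_{X ⊆ Λ, x ∈ X, X has a skeleton} e^{−κ·d(X)} ≤ 2^ν·e^{κ}·θ` (minimal-skeleton fibres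
  counted by the tree's lattice-animal bound `Polymer.sum_isConn_pow_card_le` at degree `2ν`), and the printed shape
  **`sum_exp_neg_mul_linSize_le_const`**: `Σ ≤ 2^(ν + 1 + 2^ν)` for EVERY `κ ≥ 2^ν·log 2 + log(8ν)` — an ADDITIVE threshold and
  a κ-FREE constant («≤ O(1) for κ sufficiently large»; on T⁴: κ ≥ 16·log 2 + log 32 ≈ 14.6, constant 2²¹).

Part 1b (`Support/NE9LinSizeKP.lean`, same unit) builds on §3 the Kotecký–Preiss clause, `DecayExtract` and `PinBudget` in
the currency of `d`, with additive rate conditions.  Everything here is [folklore] lattice combinatorics, kernel-proved from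
the tree's definitions; the manuscripts under audit are quoted for the TYPE of the statements only; no `def … : Prop`, no END
face of the row is touched.

HONEST FRAMING: bookkeeping for rung (B)+1 on a FIXED finite four-torus; it improves the CURRENCY in which three displayed
binders of `T4OutputRate.NE9`'s END faces can be discharged and says nothing about Bałaban's activities; NE9 is NOT PRINTED
and NOT PROVED («NE9 ⇐ the named binders»); 0∕15 leaves instantiated on Bałaban's objects; spine PROVED 0∕9; NOT infinite
volume, NOT a mass gap, NOT Clay.  HONEST DEPENDENCY: continuum YM on T⁴ ⇐ BetaPertH ∧ nine spine estimates (0/9 proved);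
BetaPertH ⇐ (D1) ∧ (D4) ∧ CAP+tail; G-an2-4 gates asym, D1 and NE2/3/4.

References (TYPES only): [I] = [Balaban1987RG1] T. Bałaban, CMP 109 (1987), p.257 (linear size, «tree graphs formed by
edges of cubes in X»); [II] = [Balaban1988RG2Cluster] T. Bałaban, CMP 116 (1988), (1.26) p.8, (2.29)–(2.30) p.18;
[FriedliVelenik2017] S. Friedli, Y. Velenik, Statistical Mechanics of Lattice Systems, Lemma 3.38 (lattice animals — in the
tree as `Polymer.sum_isConn_pow_card_le`).
-/

noncomputable section

namespace Summit.QuantumFields.BalabanUV.T4Continuum.NE9LinSizeEntropy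

open scoped BigOperators
open Literature.MathematicalPhysics.QuantumFieldTheory
open Literature.MathematicalPhysics.QuantumFieldTheory.Balaban1983to89
open Literature.MathematicalPhysics.QuantumFieldTheory.Balaban1983to89.T4HistoryLipschitzLinearSize
open Literature.MathematicalPhysics.QuantumFieldTheory.Balaban1983to89.T4HistoryLipschitzEntropy (isConn_reroot)

variable {ν : ℕ} {G : Type*} [AddCommGroup G] [One G] [DecidableEq G]

/-! ## §1 The wall adjacency has degree at most `2ν` on any coordinate group -/

/-- **degree bound** (kernel): a cube has at most `2ν` wall-neighbours `x ± e_i` in any finite family — the input of the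
lattice-animal count, cf. `T4HistoryLipschitzCubeGeometry.card_filter_torusAdj_le` on the torus. [folklore] -/
theorem card_filter_wallAdj_le (a : Fin ν → G) (Q : Finset (Fin ν → G)) :
    (Q.filter (WallAdj a)).card ≤ 2 * ν := by
  classical
  have hsub : Q.filter (WallAdj a) ⊆
      (Finset.univ : Finset (Fin ν × Bool)).image
        fun p => if p.2 then a + Pi.single p.1 1 else a - Pi.single p.1 1 := by
    intro y hy
    obtain ⟨i, hi⟩ := (Finset.mem_filter.1 hy).2
    rcases hi with h | h
    · exact Finset.mem_image.2 ⟨(i, true), Finset.mem_univ _, by simp [h]⟩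
    · exact Finset.mem_image.2 ⟨(i, false), Finset.mem_univ _, by simp [h]⟩
  calc (Q.filter (WallAdj a)).card
      ≤ ((Finset.univ : Finset (Fin ν × Bool)).image
          fun p => if p.2 then a + Pi.single p.1 1 else a - Pi.single p.1 1).card := Finset.card_le_card hsub
    _ ≤ (Finset.univ : Finset (Fin ν × Bool)).card := Finset.card_image_le
    _ = 2 * ν := by simp [Finset.card_univ, mul_comm]

/-! ## §2 Skeleton points are corners of cubes; skeletons are wall-connected lattice animals -/

omit [DecidableEq G] in
/-- the endpoints of a cube edge are wall-adjacent lattice points (`c' = c ± e_i`). [folklore] -/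
theorem wallAdj_of_edgeAdj {X : Finset (Fin ν → G)} {c c' : Fin ν → G} (h : EdgeAdj X c c') : WallAdj c c' := by
  obtain ⟨i, hi⟩ := exists_single_of_edgeAdj h
  rcases hi with h1 | h1
  · exact ⟨i, Or.inl h1⟩
  · exact ⟨i, Or.inr (by rw [h1, add_sub_cancel_right])⟩

omit [DecidableEq G] in
/-- the first endpoint of a cube edge of `X` is a corner of a cube of `X`. [folklore] -/
theorem exists_isCorner_of_edgeAdj_left {X : Finset (Fin ν → G)} {c c' : Fin ν → G} (h : EdgeAdj X c c') :
    ∃ m ∈ X, IsCorner m c := by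
  obtain ⟨m, hm, ε, i, -, h'⟩ := h
  rcases h' with ⟨hc, -⟩ | ⟨-, hc⟩
  · exact ⟨m, hm, ε, hc⟩
  · exact ⟨m, hm, insert i ε, hc⟩

omit [DecidableEq G] in
/-- the second endpoint of a cube edge of `X` is a corner of a cube of `X`. [folklore] -/
theorem exists_isCorner_of_edgeAdj_right {X : Finset (Fin ν → G)} {c c' : Fin ν → G} (h : EdgeAdj X c c') :
    ∃ m ∈ X, IsCorner m c' := by
  obtain ⟨m, hm, ε, i, -, h'⟩ := h
  rcases h' with ⟨-, hc'⟩ | ⟨hc', -⟩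
  · exact ⟨m, hm, insert i ε, hc'⟩
  · exact ⟨m, hm, ε, hc'⟩

omit [DecidableEq G] in
/-- **every point of a lattice skeleton of a NONEMPTY cube family is a corner of one of its cubes** (a point joined to
another skeleton point is an endpoint of a cube edge; a one-point skeleton is a common corner). [cite: Balaban1987RG1, p.257] -/
theorem exists_isCorner_of_mem_skeleton {X S : Finset (Fin ν → G)} (hS : IsSkeleton X S) (hX : X.Nonempty)
    {c : Fin ν → G} (hc : c ∈ S) : ∃ m ∈ X, IsCorner m c := by
  obtain ⟨⟨a, _, hconn⟩, hcov⟩ := hS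
  rcases Relation.ReflTransGen.cases_tail (Polymer.reach_iff.1 (hconn.2 c hc)) with h | ⟨b, -, hbc⟩
  · -- `c` is the root: use the path from the root to a corner of some cube
    subst h
    obtain ⟨m, hm⟩ := hX
    obtain ⟨c₀, hc₀, hmc₀⟩ := hcov m hm
    rcases Relation.ReflTransGen.cases_head (Polymer.reach_iff.1 (hconn.2 c₀ hc₀)) with h0 | ⟨b, hab, -⟩
    · subst h0; exact ⟨m, hm, hmc₀⟩
    · exact exists_isCorner_of_edgeAdj_left hab.2.2
  · exact exists_isCorner_of_edgeAdj_right hbc.2.2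

omit [DecidableEq G] in
/-- **a lattice skeleton is a wall-connected set of lattice points** (cube edges are unit steps). [folklore] -/
theorem isConn_wallAdj_of_isSkeleton {X S : Finset (Fin ν → G)} (hS : IsSkeleton X S) :
    ∃ a ∈ S, Polymer.IsConn WallAdj S a := by
  obtain ⟨⟨a, ha, hconn⟩, -⟩ := hS
  exact ⟨a, ha, isConn_mono_rel (fun _ _ _ _ h => wallAdj_of_edgeAdj h) hconn⟩

/-! ## §3 The entropy bound in the linear size ([II] (1.26) p.8 ∕ (2.29) p.18 TYPE, additive threshold) -/

/-- the corners of a cube `m`: the `2^ν` lattice points `m + Σ_{i∈ε} e_i`. [folklore] -/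
theorem card_image_cornerVec_le (m : Fin ν → G) :
    ((Finset.univ : Finset (Finset (Fin ν))).image fun ε => m + cornerVec ε).card ≤ 2 ^ ν :=
  Finset.card_image_le.trans (by simp)

/-- the cubes cornered at a point set `S` (`m = c − Σ_{i∈ε} e_i`, `c ∈ S`) number at most `2^ν·#S`
(cf. `card_le_two_pow_mul_card`). [folklore] -/
theorem card_image_sub_cornerVec_le (S : Finset (Fin ν → G)) :
    ((S ×ˢ (Finset.univ : Finset (Finset (Fin ν)))).image fun p => p.1 - cornerVec p.2).card ≤ 2 ^ ν * S.card :=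
  Finset.card_image_le.trans (by
    rw [Finset.card_product, Finset.card_univ, Fintype.card_finset, Fintype.card_fin, mul_comm])

open Classical in
/-- **THE ENTROPY BOUND IN THE LINEAR SIZE (kernel; [II] (1.26) p.8 ∕ (2.29) p.18 TYPE).**  For a finite region `Λ` of cubes
(lower corners in `Fin ν → G`), a cube `x` and reals `κ, θ` with `2^(2^ν)·e^{−κ}·e^{2ν·θ} ≤ θ`:
`Σ_{X ⊆ Λ, x ∈ X, X has a lattice skeleton} e^{−κ·d(X)} ≤ 2^ν·e^{κ}·θ`.  Proof: choose a minimal skeleton `S(X)`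
(`#S(X) = d(X) + 1`); it is a `WallAdj`-animal inside the corners of `Λ` through one of the `2^ν` corners of `x` (§2), and at
most `2^(#cubes cornered at S) ≤ 2^(2^ν·#S)` families share it; sum the fibres with `Polymer.sum_isConn_pow_card_le` (degree
`2ν`, §1).  Printed TYPE: «Σ_{X∈𝐃_j, X⊃□′} exp(−κd_j(X)) ≤ O(1), (1.26) for κ sufficiently large».
[cite: Balaban1988RG2Cluster, (1.26) p.8 and (2.29) p.18; FriedliVelenik2017, Lemma 3.38] -/
theorem sum_exp_neg_mul_linSize_le (Λ : Finset (Fin ν → G)) (x : Fin ν → G) {κ θ : ℝ}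
    (hθ : (2:ℝ) ^ (2 ^ ν) * Real.exp (-κ) * Real.exp ((2 * ν : ℕ) * θ) ≤ θ) :
    ∑ X ∈ Λ.powerset.filter (fun X => x ∈ X ∧ ∃ S, IsSkeleton X S), Real.exp (-(κ * (linSize X : ℝ))) ≤
      2 ^ ν * Real.exp κ * θ := by
  set T := Λ.powerset.filter (fun X => x ∈ X ∧ ∃ S, IsSkeleton X S) with hT
  set w : ℝ := (2:ℝ) ^ (2 ^ ν) * Real.exp (-κ) with hw
  have hw0 : 0 ≤ w := by positivity
  have hθ0 : 0 ≤ θ := le_trans (by positivity) hθ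
  -- the corners of a cube, the corners of the region, the cubes cornered at a point set
  set cor : (Fin ν → G) → Finset (Fin ν → G) :=
    fun m => (Finset.univ : Finset (Finset (Fin ν))).image fun ε => m + cornerVec ε with hcor
  set ΛC : Finset (Fin ν → G) := Λ.biUnion cor with hΛC
  set cub : Finset (Fin ν → G) → Finset (Fin ν → G) :=
    fun S => (S ×ˢ (Finset.univ : Finset (Finset (Fin ν)))).image fun p => p.1 - cornerVec p.2 with hcub
  -- a minimal skeleton for every member of the family
  have hsk : ∀ X ∈ T, ∃ S, IsSkeleton X S ∧ S.card = linSize X + 1 := fun X hX =>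
    exists_isSkeleton_card_eq (Finset.mem_filter.1 hX).2.2
  choose! sk hsk1 hsk2 using hsk
  have hxT : ∀ X ∈ T, x ∈ X := fun X hX => (Finset.mem_filter.1 hX).2.1
  have hXΛ : ∀ X ∈ T, X ⊆ Λ := fun X hX => Finset.mem_powerset.1 (Finset.mem_filter.1 hX).1
  have hS_sub : ∀ X ∈ T, sk X ⊆ ΛC := by
    intro X hX c hc
    obtain ⟨m, hm, ε, hcε⟩ := exists_isCorner_of_mem_skeleton (hsk1 X hX) ⟨x, hxT X hX⟩ hc
    exact Finset.mem_biUnion.2 ⟨m, hXΛ X hX hm, Finset.mem_image.2 ⟨ε, Finset.mem_univ _, hcε.symm⟩⟩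
  have hS_conn : ∀ X ∈ T, ∃ v ∈ cor x, Polymer.IsConn WallAdj (sk X) v := by
    intro X hX
    obtain ⟨c, hc, ε, hcε⟩ := (hsk1 X hX).2 x (hxT X hX)
    obtain ⟨a, _, hconn⟩ := isConn_wallAdj_of_isSkeleton (hsk1 X hX)
    exact ⟨c, Finset.mem_image.2 ⟨ε, Finset.mem_univ _, hcε.symm⟩, isConn_reroot hconn hc⟩
  have hX_cub : ∀ X ∈ T, X ⊆ cub (sk X) := by
    intro X hX m hm
    obtain ⟨c, hc, ε, hcε⟩ := (hsk1 X hX).2 m hm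
    refine Finset.mem_image.2 ⟨(c, ε), Finset.mem_product.2 ⟨hc, Finset.mem_univ _⟩, ?_⟩
    simp only [hcε, add_sub_cancel_right]
  -- the candidate skeletons: wall-connected animals in the corners of the region, rooted at a corner of `x`
  set 𝒮 := ΛC.powerset.filter (fun S => ∃ v ∈ cor x, Polymer.IsConn WallAdj S v) with h𝒮
  have hmaps : ∀ X ∈ T, sk X ∈ 𝒮 := fun X hX =>
    Finset.mem_filter.2 ⟨Finset.mem_powerset.2 (hS_sub X hX), hS_conn X hX⟩
  have hterm : ∀ X ∈ T, Real.exp (-(κ * (linSize X : ℝ))) = Real.exp κ * Real.exp (-κ) ^ (sk X).card := by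
    intro X hX
    rw [← Real.exp_nat_mul, ← Real.exp_add]
    congr 1
    have : ((sk X).card : ℝ) = (linSize X : ℝ) + 1 := by exact_mod_cast hsk2 X hX
    rw [this]; ring
  have hfib : ∀ S ∈ 𝒮, ∑ X ∈ T.filter (fun X => sk X = S), Real.exp (-(κ * (linSize X : ℝ))) ≤
      Real.exp κ * w ^ S.card := by
    intro S _
    have hsub : T.filter (fun X => sk X = S) ⊆ (cub S).powerset := by
      intro X hX
      obtain ⟨hXT, hXS⟩ := Finset.mem_filter.1 hX
      exact Finset.mem_powerset.2 (hXS ▸ hX_cub X hXT)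
    have hcard : ((T.filter fun X => sk X = S).card : ℝ) ≤ (2:ℝ) ^ (2 ^ ν * S.card) := by
      have h1 : (T.filter fun X => sk X = S).card ≤ 2 ^ (cub S).card := by
        simpa only [Finset.card_powerset] using Finset.card_le_card hsub
      have h2 : 2 ^ (cub S).card ≤ 2 ^ (2 ^ ν * S.card) :=
        Nat.pow_le_pow_right (by norm_num) (card_image_sub_cornerVec_le S)
      exact_mod_cast h1.trans h2
    calc ∑ X ∈ T.filter (fun X => sk X = S), Real.exp (-(κ * (linSize X : ℝ)))
        = ∑ X ∈ T.filter (fun X => sk X = S), Real.exp κ * Real.exp (-κ) ^ S.card := by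
          refine Finset.sum_congr rfl fun X hX => ?_
          obtain ⟨hXT, hXS⟩ := Finset.mem_filter.1 hX
          rw [hterm X hXT, hXS]
      _ = ((T.filter fun X => sk X = S).card : ℝ) * (Real.exp κ * Real.exp (-κ) ^ S.card) := by
          rw [Finset.sum_const, nsmul_eq_mul]
      _ ≤ (2:ℝ) ^ (2 ^ ν * S.card) * (Real.exp κ * Real.exp (-κ) ^ S.card) :=
          mul_le_mul_of_nonneg_right hcard (by positivity)
      _ = Real.exp κ * w ^ S.card := by rw [hw, mul_pow, ← pow_mul]; ring
  have hcorx : ((cor x).card : ℝ) ≤ 2 ^ ν := by exact_mod_cast card_image_cornerVec_le x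
  calc ∑ X ∈ T, Real.exp (-(κ * (linSize X : ℝ)))
      = ∑ S ∈ 𝒮, ∑ X ∈ T.filter (fun X => sk X = S), Real.exp (-(κ * (linSize X : ℝ))) :=
        (Finset.sum_fiberwise_of_maps_to hmaps _).symm
    _ ≤ ∑ S ∈ 𝒮, Real.exp κ * w ^ S.card := Finset.sum_le_sum hfib
    _ = Real.exp κ * ∑ S ∈ 𝒮, w ^ S.card := by rw [Finset.mul_sum]
    _ ≤ Real.exp κ * (2 ^ ν * θ) := by
        refine mul_le_mul_of_nonneg_left ?_ (Real.exp_pos κ).le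
        calc ∑ S ∈ 𝒮, w ^ S.card
            ≤ ∑ S ∈ (cor x).biUnion (fun v => ΛC.powerset.filter fun S => Polymer.IsConn WallAdj S v),
                w ^ S.card := by
              refine Finset.sum_le_sum_of_subset_of_nonneg ?_ fun _ _ _ => pow_nonneg hw0 _
              intro S hS
              obtain ⟨hSΛ, v, hv, hc⟩ := Finset.mem_filter.1 hS
              exact Finset.mem_biUnion.2 ⟨v, hv, Finset.mem_filter.2 ⟨hSΛ, hc⟩⟩
          _ ≤ ∑ v ∈ cor x, ∑ S ∈ ΛC.powerset.filter (fun S => Polymer.IsConn WallAdj S v), w ^ S.card :=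
              Polymer.sum_biUnion_le_sum (cor x) _ _ fun _ => pow_nonneg hw0 _
          _ ≤ ∑ v ∈ cor x, θ := Finset.sum_le_sum fun v _ =>
              Polymer.sum_isConn_pow_card_le (adj := WallAdj) (2 * ν) card_filter_wallAdj_le hw0 hθ ΛC v
          _ = ((cor x).card : ℝ) * θ := by rw [Finset.sum_const, nsmul_eq_mul]
          _ ≤ 2 ^ ν * θ := mul_le_mul_of_nonneg_right hcorx hθ0
    _ = 2 ^ ν * Real.exp κ * θ := by ring

open Classical in
/-- **THE PRINTED SHAPE: a κ-FREE constant above an ADDITIVE threshold** — for every `κ ≥ 2^ν·log 2 + log(8ν)`: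
`Σ_{X ⊆ Λ, x ∈ X, X has a lattice skeleton} e^{−κ·d(X)} ≤ 2^(ν + 1 + 2^ν)` (§3 with `θ = 2·2^(2^ν)·e^{−κ}`, using
`4ν·2^(2^ν)·e^{−κ} ≤ ½ < log 2`).  [II] (1.26) p.8 «≤ O(1), (1.26) for κ sufficiently large»; on T⁴ (`ν = 4`): κ ≥ 16·log 2
+ log 32, constant `2²¹`. [cite: Balaban1988RG2Cluster, (1.26) p.8 and (2.29) p.18] -/
theorem sum_exp_neg_mul_linSize_le_const (Λ : Finset (Fin ν → G)) (x : Fin ν → G) {κ : ℝ}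
    (hκ : (2:ℝ) ^ ν * Real.log 2 + Real.log (8 * ν) ≤ κ) :
    ∑ X ∈ Λ.powerset.filter (fun X => x ∈ X ∧ ∃ S, IsSkeleton X S), Real.exp (-(κ * (linSize X : ℝ))) ≤
      (2:ℝ) ^ (ν + 1 + 2 ^ ν) := by
  set w : ℝ := (2:ℝ) ^ (2 ^ ν) * Real.exp (-κ) with hw
  have hw0 : 0 ≤ w := by positivity
  -- `2^(2^ν) = e^{2^ν·log 2}`
  have h2pow : (2:ℝ) ^ (2 ^ ν) = Real.exp ((2:ℝ) ^ ν * Real.log 2) := by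
    rw [← Real.rpow_natCast, Real.rpow_def_of_pos (by norm_num : (0:ℝ) < 2)]
    congr 1; push_cast; ring
  -- smallness of `w`: `4ν·w ≤ ½`
  have hνw : 4 * (ν : ℝ) * w ≤ 1 / 2 := by
    rcases Nat.eq_zero_or_pos ν with hν | hν
    · subst hν; simp
    · have hν' : (0:ℝ) < 8 * ν := by positivity
      have hwle : w ≤ 1 / (8 * ν) := by
        rw [hw, h2pow, ← Real.exp_add, one_div]
        have : Real.exp ((2:ℝ) ^ ν * Real.log 2 + -κ) ≤ Real.exp (-Real.log (8 * ν)) :=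
          Real.exp_le_exp.2 (by linarith)
        rwa [Real.exp_neg, Real.exp_log hν'] at this
      calc 4 * (ν : ℝ) * w ≤ 4 * ν * (1 / (8 * ν)) := by gcongr
        _ = 1 / 2 := by field_simp; ring
  -- the hypothesis of §3 with `θ = 2w`
  have hθ : (2:ℝ) ^ (2 ^ ν) * Real.exp (-κ) * Real.exp ((2 * ν : ℕ) * (2 * w)) ≤ 2 * w := by
    rw [← hw]
    have hexp : Real.exp ((2 * ν : ℕ) * (2 * w)) ≤ 2 := by
      have h1 : ((2 * ν : ℕ) : ℝ) * (2 * w) = 4 * ν * w := by push_cast; ring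
      rw [h1]
      calc Real.exp (4 * ν * w) ≤ Real.exp (1 / 2) := Real.exp_le_exp.2 hνw
        _ ≤ 2 := by
          have := Real.add_one_le_exp (Real.log 2 - 1 / 2)
          have hlog : (1:ℝ) / 2 < Real.log 2 := by
            have := Real.log_two_gt_d9; linarith
          calc Real.exp (1 / 2) ≤ Real.exp (Real.log 2) := Real.exp_le_exp.2 hlog.le
            _ = 2 := Real.exp_log (by norm_num)
    calc w * Real.exp ((2 * ν : ℕ) * (2 * w)) ≤ w * 2 := mul_le_mul_of_nonneg_left hexp hw0
      _ = 2 * w := by ring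
  calc ∑ X ∈ Λ.powerset.filter (fun X => x ∈ X ∧ ∃ S, IsSkeleton X S), Real.exp (-(κ * (linSize X : ℝ)))
      ≤ 2 ^ ν * Real.exp κ * (2 * w) := sum_exp_neg_mul_linSize_le Λ x hθ
    _ = (2:ℝ) ^ (ν + 1 + 2 ^ ν) := by
        rw [hw, pow_add, pow_add, pow_one]
        have : Real.exp κ * Real.exp (-κ) = 1 := by rw [← Real.exp_add, add_neg_cancel, Real.exp_zero]
        calc (2:ℝ) ^ ν * Real.exp κ * (2 * (2 ^ 2 ^ ν * Real.exp (-κ)))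
            = 2 ^ ν * 2 * 2 ^ 2 ^ ν * (Real.exp κ * Real.exp (-κ)) := by ring
          _ = 2 ^ ν * 2 * 2 ^ 2 ^ ν := by rw [this, mul_one]

end Summit.QuantumFields.BalabanUV.T4Continuum.NE9LinSizeEntropy

end
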